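import Summits.BirchSwinnertonDyer.Rank1Residual.AdditivePotMult.QuadraticTwistTypeIVNormalForm
import Summits.BirchSwinnertonDyer.Rank1Residual.AdditivePotMult.QuadraticBaseChangeSplitParity
import HarnessLib

/-!
# Type-`IV` / `IV*` Tamagawa numbers under an UNRAMIFIED extension of discrete valuation rings:
# `c = 3` upstairs iff the SAME Step-5/8 quadratic has a root in the bigger residue field; even
# residue degree ⇒ `c = 3`, odd residue degree ⇒ `c` unchanged (row T-MIL-B, file B-2c; seat n1011-p08 GEN 3)

HONEST FRAMING (cell `b2b-bsdres`, run/shared/lean/b2b/bsd-rank1-residual/, verbatim in every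
file): the goal of the cell is to DELETE the COMBINATION-SHAPED residual classes of the
Birch–Swinnerton-Dyer formula for ALL analytic-rank `≤ 1` elliptic curves over `ℚ` — "full BSD
formula for every rank `≤ 1` curve in class `C`" assembled STRICTLY from published theorems — so
that the rank-`≤ 1` remainder becomes exactly the CONSTRUCTION-SHAPED classes, which are TYPED
(missing-input `Prop`s), NOT attempted. This is not "finishing BSD". Sub-classes X3♯(M) / X4(M)
(additive, base-change-and-descend): a RESEARCH ROUTE; they stay CONSTRUCTION-SHAPED; nothing is
booked by this file; no mark / label moved; no consumer binder (`hWR`, `hodd`, A65/A73) changes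
before T-MIL-ODD stage C. THEOREMS ONLY: no definition, no named fact, no `sorry`. OUT OF THIS
ROW (said in every file): the wild sub-case `ℓ = 3 = p ∣ d_K` and `ℓ = 2`.

## Setting and what (skeleton `cells/n1011/skel/T-MIL-B.md` §1 (B2)(i); referee-1 proviso (i))

An ABSTRACT extension of discrete valuation rings `R₀ → R` with fraction fields `F → L`
(`IsScalarTower R₀ R L`, `IsScalarTower R₀ F L`, local homomorphism), UNRAMIFIED in the sense
that a uniformiser `ϖ₀` of `R₀` stays irreducible in `R` — the shape of `O_v → O_w` for a place
`w ∣ v` with `e(w ∣ v) = 1`; the instantiation at number-field places (the `Algebra O_v O_w`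
datum on completions) is NOT done here (stage C / the S15-layer files; said loudly).

* `baseChange_map_eq` / `smul_baseChange_eq_map_baseChange` — an `R₀`-model `J` of `W/F`
  (`D • W = J ⊗ F`) gives the `R`-model `J.map φ` of `W ⊗ L`;
* `normalForm_IV_map` / `normalForm_IVstar_map` — a type-`IV` (`IV*`) normal form maps to a
  normal form of the same type w.r.t. `φ ϖ₀`, with `γ' = φγ`, `ε' = φε` and the residual quadratic
  MAPPED along `k₀ → k` (separability preserved);
* `localTamagawaNumber_baseChange_eq_three_iff_of_normalForm_IV[_star]` — (`R` Henselian)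
  **`c((W ⊗ L)/L) = 3 ↔ Y² + γ̄Y − ε̄` has a root in `k`** (exact index B-1a/b over `R`);
* `…_eq_three_of_even_finrank_…` — `k/k₀` FINITE of EVEN degree ⇒ the separable quadratic splits in
  `k` (n1011-p01's `splits_map_of_natDegree_eq_two_of_even_finrank`, A-1a) ⇒ **`c = 3`** — the
  INERT base-change entry of (L_ℓ)@3 (printed remark: Dokchitser–Dokchitser, *Ann. Math.* 172 (2010)
  p. 580, Case 4c, cited as corroboration only);
* `…_iff_of_odd_finrank_…` — ODD degree ⇒ **`c((W ⊗ L)/L) = 3 ↔ c(W/F) = 3`** (`R₀` Henselian too).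

Minimality of `(J.map φ) ⊗ L` over `R` is an EXPLICIT instance binder (referee-1 proviso (i): a
Tate-termination theorem or a binder, never an `ord Δ < 12` shortcut at residue characteristic 3);
the tree's named fact `kodairaSymbolAt_baseChange_of_ramificationIdx_eq_one` (Silverman *AEC*
VII.5.4 (a): a `v`-minimal equation stays `w`-minimal when `e = 1`) is what discharges it at places.
References: Silverman *ATAEC* IV.9.4 Steps 5, 8; *AEC* VII.5.4 (a).
-/

noncomputable section

open scoped Classical

open WeierstrassCurve IsLocalRing Polynomial
  Literature.NumberTheory.EllipticCurves Literature.NumberTheory.EllipticCurves.LocalIndex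
  Literature.NumberTheory.DiophantineGeometry.TateAlgorithm

namespace Summit.BirchSwinnertonDyer.Rank1Residual.AdditivePotMult

namespace TypeIVTwist

/-! ### The transported model (pure algebra) -/

section Transport

variable {R₀ : Type*} [CommRing R₀] {F : Type*} [Field F] [Algebra R₀ F]
  {R : Type*} [CommRing R] {L : Type*} [Field L] [Algebra R L]
  [Algebra R₀ R] [Algebra F L] [Algebra R₀ L] [IsScalarTower R₀ R L] [IsScalarTower R₀ F L]

/-- `(J.map φ) ⊗ L = (J ⊗ F) ⊗ L` for the structure map `φ : R₀ → R` of a square of algebras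
`R₀ → R → L`, `R₀ → F → L`. [folklore] -/
theorem baseChange_map_eq (J : WeierstrassCurve R₀) :
    (J.map (algebraMap R₀ R)).baseChange L = (J.baseChange F).baseChange L := by
  show J.map ((algebraMap R L).comp (algebraMap R₀ R)) =
    J.map ((algebraMap F L).comp (algebraMap R₀ F))
  rw [← IsScalarTower.algebraMap_eq R₀ R L, ← IsScalarTower.algebraMap_eq R₀ F L]

/-- An `R₀`-model of `W/F` gives an `R`-model of `W ⊗ L`: `D • W = J ⊗ F` implies
`D_L • (W ⊗ L) = (J.map φ) ⊗ L`. [folklore] -/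
theorem smul_baseChange_eq_map_baseChange (W : WeierstrassCurve F) (J : WeierstrassCurve R₀)
    (D : VariableChange F) (hJ : D • W = J.baseChange F) :
    D.map (algebraMap F L) • W.baseChange L = (J.map (algebraMap R₀ R)).baseChange L := by
  rw [baseChange_map_eq (F := F) J, ← hJ, WeierstrassCurve.baseChange, WeierstrassCurve.baseChange,
    WeierstrassCurve.map_variableChange]

end Transport

/-! ### Normal forms map to normal forms along a local homomorphism -/

section LocalHom

variable {R₀ : Type*} [CommRing R₀] [IsDomain R₀] [IsDiscreteValuationRing R₀]
  (R : Type*) [CommRing R] [IsLocalRing R] [Algebra R₀ R] [IsLocalHom (algebraMap R₀ R)]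

/-- `x ∈ 𝔪₀ⁿ ⇒ φ x ∈ 𝔪ⁿ` for a local homomorphism `φ : R₀ → R` out of a discrete valuation ring
(`x = ϖ₀ⁿ y` and `φ ϖ₀ ∈ 𝔪`). [folklore] -/
theorem map_mem_maximalIdeal_pow {x : R₀} {n : ℕ} (hx : x ∈ maximalIdeal R₀ ^ n) :
    algebraMap R₀ R x ∈ maximalIdeal R ^ n := by
  have hϖ₀ : Irreducible (uniformizer R₀) := irreducible_uniformizer
  rw [hϖ₀.maximalIdeal_eq, Ideal.span_singleton_pow, Ideal.mem_span_singleton] at hx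
  obtain ⟨y, rfl⟩ := hx
  rw [map_mul, map_pow]
  exact Ideal.mul_mem_right _ _ (Ideal.pow_mem_pow (map_nonunit (algebraMap R₀ R) _
    ((IsLocalRing.mem_maximalIdeal _).mpr hϖ₀.not_isUnit)) n)

/-- The residual discriminant transports along `k₀ → k`: `γ̄'² + 4ε̄' ≠ 0 ↔ γ̄² + 4ε̄ ≠ 0`.
[folklore] -/
theorem residue_disc_map_ne_zero_iff (γ ε : R₀) :
    residue R (algebraMap R₀ R γ) ^ 2 + 4 * residue R (algebraMap R₀ R ε) ≠ 0 ↔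
      residue R₀ γ ^ 2 + 4 * residue R₀ ε ≠ 0 := by
  have e : residue R (algebraMap R₀ R γ) ^ 2 + 4 * residue R (algebraMap R₀ R ε) =
      algebraMap (ResidueField R₀) (ResidueField R) (residue R₀ γ ^ 2 + 4 * residue R₀ ε) := by
    simp only [map_add, map_mul, map_pow, map_ofNat, ResidueField.algebraMap_residue]
  rw [e, map_ne_zero_iff _ (algebraMap (ResidueField R₀) (ResidueField R)).injective]

/-- **A type-`IV` normal form maps to a type-`IV` normal form** along a local homomorphism
`φ : R₀ → R` (w.r.t. `φ ϖ₀`): `a₁', a₂' ∈ 𝔪`, `a₃' = (φϖ₀)(φγ)`, `a₄' ∈ 𝔪²`, `a₆' = (φϖ₀)²(φε)`.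
[folklore] -/
theorem normalForm_IV_map (J : WeierstrassCurve R₀) (h1 : J.a₁ ∈ maximalIdeal R₀)
    (h2 : J.a₂ ∈ maximalIdeal R₀) {ϖ₀ γ ε : R₀} (hγ : J.a₃ = ϖ₀ * γ) (h4 : J.a₄ ∈ maximalIdeal R₀ ^ 2)
    (hε : J.a₆ = ϖ₀ ^ 2 * ε) :
    (J.map (algebraMap R₀ R)).a₁ ∈ maximalIdeal R ∧ (J.map (algebraMap R₀ R)).a₂ ∈ maximalIdeal R ∧
      (J.map (algebraMap R₀ R)).a₃ = algebraMap R₀ R ϖ₀ * algebraMap R₀ R γ ∧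
      (J.map (algebraMap R₀ R)).a₄ ∈ maximalIdeal R ^ 2 ∧
      (J.map (algebraMap R₀ R)).a₆ = algebraMap R₀ R ϖ₀ ^ 2 * algebraMap R₀ R ε := by
  refine ⟨map_nonunit _ _ h1, map_nonunit _ _ h2, ?_, map_mem_maximalIdeal_pow R h4, ?_⟩
  · simp only [WeierstrassCurve.map_a₃, hγ, map_mul]
  · simp only [WeierstrassCurve.map_a₆, hε, map_mul, map_pow]

/-- **A type-`IV*` normal form maps to a type-`IV*` normal form** along a local `φ : R₀ → R`
(w.r.t. `φ ϖ₀`): `a₁' ∈ 𝔪`, `a₂' ∈ 𝔪²`, `a₃' = (φϖ₀)²(φγ)`, `a₄' ∈ 𝔪³`, `a₆' = (φϖ₀)⁴(φε)`.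
[folklore] -/
theorem normalForm_IVstar_map (J : WeierstrassCurve R₀) (h1 : J.a₁ ∈ maximalIdeal R₀)
    (h2 : J.a₂ ∈ maximalIdeal R₀ ^ 2) {ϖ₀ γ ε : R₀} (hγ : J.a₃ = ϖ₀ ^ 2 * γ)
    (h4 : J.a₄ ∈ maximalIdeal R₀ ^ 3) (hε : J.a₆ = ϖ₀ ^ 4 * ε) :
    (J.map (algebraMap R₀ R)).a₁ ∈ maximalIdeal R ∧
      (J.map (algebraMap R₀ R)).a₂ ∈ maximalIdeal R ^ 2 ∧
      (J.map (algebraMap R₀ R)).a₃ = algebraMap R₀ R ϖ₀ ^ 2 * algebraMap R₀ R γ ∧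
      (J.map (algebraMap R₀ R)).a₄ ∈ maximalIdeal R ^ 3 ∧
      (J.map (algebraMap R₀ R)).a₆ = algebraMap R₀ R ϖ₀ ^ 4 * algebraMap R₀ R ε := by
  refine ⟨map_nonunit _ _ h1, map_mem_maximalIdeal_pow R h2, ?_, map_mem_maximalIdeal_pow R h4, ?_⟩
  · simp only [WeierstrassCurve.map_a₃, hγ, map_mul, map_pow]
  · simp only [WeierstrassCurve.map_a₆, hε, map_mul, map_pow]

end LocalHom

/-! ### The Step-5/8 quadratic as a polynomial -/

/-- `Y² + āY − c̄` read in an extension `i : k₀ → E`: "has a root in `E`" is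
"`(q.map i).Splits`" for this degree-`2` polynomial. [folklore] -/
theorem exists_root_map_iff_splits {k₀ E : Type*} [Field k₀] [Field E] (i : k₀ →+* E) (a c : k₀) :
    (∃ r : E, r ^ 2 + i a * r - i c = 0) ↔ ((X ^ 2 + C a * X - C c).map i).Splits := by
  have hmap : (X ^ 2 + C a * X - C c : k₀[X]).map i = X ^ 2 + C (i a) * X - C (i c) := by
    simp [Polynomial.map_sub, Polynomial.map_add, Polynomial.map_mul]
  have e : (X ^ 2 + C (i a) * X - C (i c) : E[X]) = C 1 * X ^ 2 + C (i a) * X + C (-(i c)) := by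
    simp only [map_one, one_mul, map_neg]; ring
  have hdeg : (X ^ 2 + C (i a) * X - C (i c) : E[X]).natDegree = 2 := by
    rw [e]; exact natDegree_quadratic one_ne_zero
  rw [hmap]
  constructor
  · rintro ⟨r, hr⟩
    exact Splits.of_natDegree_eq_two hdeg (x := r)
      (by simp only [eval_sub, eval_add, eval_pow, eval_X, eval_mul, eval_C]; linear_combination hr)
  · intro h
    have hdeg0 : (X ^ 2 + C (i a) * X - C (i c) : E[X]).degree ≠ 0 := by
      rw [e, degree_quadratic one_ne_zero]; decide
    obtain ⟨r, hr⟩ := h.exists_eval_eq_zero hdeg0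
    exact ⟨r, by simpa [eval_sub, eval_add, eval_pow, eval_X, eval_mul, eval_C] using hr⟩

/-- The Step-5/8 quadratic `Y² + āY − c̄` has natural degree `2`. [folklore] -/
theorem natDegree_stepQuadratic {k₀ : Type*} [Field k₀] (a c : k₀) :
    (X ^ 2 + C a * X - C c : k₀[X]).natDegree = 2 := by
  have e : (X ^ 2 + C a * X - C c : k₀[X]) = C 1 * X ^ 2 + C a * X + C (-c) := by
    simp only [map_one, one_mul, map_neg]; ring
  rw [e]; exact natDegree_quadratic one_ne_zero

/-! ### `c` upstairs, read on the mapped normal form -/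

section Extension

variable {R₀ : Type*} [CommRing R₀] [IsDomain R₀] [IsDiscreteValuationRing R₀]
  {F : Type*} [Field F] [Algebra R₀ F] [IsFractionRing R₀ F]
  {R : Type*} [CommRing R] [IsDomain R] [IsDiscreteValuationRing R]
  {L : Type*} [Field L] [Algebra R L] [IsFractionRing R L]
  [Algebra R₀ R] [Algebra F L] [Algebra R₀ L] [IsScalarTower R₀ R L] [IsScalarTower R₀ F L]
  [IsLocalHom (algebraMap R₀ R)]

omit [IsFractionRing R₀ F] in
/-- **Type `IV` after an UNRAMIFIED extension (`φ ϖ₀` irreducible in `R`, `R` Henselian):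
`c((W ⊗ L)/L) = 3 ↔` the Step-5 quadratic `Y² + γ̄Y − ε̄` of the normal form `J` of `W` has a root
IN THE RESIDUE FIELD OF `R`** (the same quadratic, read upstairs). Minimality of `(J.map φ) ⊗ L`
over `R` is an explicit instance binder (Silverman *AEC* VII.5.4 (a) at places).
[cite: SilvermanATAEC1994, IV.9.4 Step 5 (PDF p. 344)] [cite: SilvermanAEC2009, Prop. VII.5.4 (a)] -/
theorem localTamagawaNumber_baseChange_eq_three_iff_of_normalForm_IV [HenselianLocalRing R]
    (W : WeierstrassCurve F) [W.IsElliptic] (J : WeierstrassCurve R₀) (D : VariableChange F)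
    (hJ : D • W = J.baseChange F) [((J.map (algebraMap R₀ R)).baseChange L).IsMinimal R]
    (h1 : J.a₁ ∈ maximalIdeal R₀) (h2 : J.a₂ ∈ maximalIdeal R₀) {ϖ₀ γ ε : R₀}
    (hϖ : Irreducible (algebraMap R₀ R ϖ₀)) (hγ : J.a₃ = ϖ₀ * γ) (h4 : J.a₄ ∈ maximalIdeal R₀ ^ 2)
    (hε : J.a₆ = ϖ₀ ^ 2 * ε) (hdisc : residue R₀ γ ^ 2 + 4 * residue R₀ ε ≠ 0) :
    (W.baseChange L).localTamagawaNumber R = 3 ↔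
      ∃ r : ResidueField R, r ^ 2 + residue R (algebraMap R₀ R γ) * r -
        residue R (algebraMap R₀ R ε) = 0 := by
  haveI : (W.baseChange L).IsElliptic := by rw [WeierstrassCurve.baseChange]; infer_instance
  obtain ⟨h1', h2', hγ', h4', hε'⟩ := normalForm_IV_map R J h1 h2 hγ h4 hε
  exact localTamagawaNumber_eq_three_iff_exists_root_of_normalForm_IV (W.baseChange L)
    (J.map (algebraMap R₀ R)) (D.map (algebraMap F L))
    (smul_baseChange_eq_map_baseChange W J D hJ) h1' h2' hϖ hγ' h4' hε'
    ((residue_disc_map_ne_zero_iff R γ ε).mpr hdisc)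

omit [IsFractionRing R₀ F] in
/-- **Type `IV*` after an UNRAMIFIED extension**: `c((W ⊗ L)/L) = 3 ↔` the Step-8 quadratic of
the normal form has a root in the residue field of `R`.
[cite: SilvermanATAEC1994, IV.9.4 Step 8 (PDF p. 346)] [cite: SilvermanAEC2009, Prop. VII.5.4 (a)] -/
theorem localTamagawaNumber_baseChange_eq_three_iff_of_normalForm_IVstar [HenselianLocalRing R]
    (W : WeierstrassCurve F) [W.IsElliptic] (J : WeierstrassCurve R₀) (D : VariableChange F)
    (hJ : D • W = J.baseChange F) [((J.map (algebraMap R₀ R)).baseChange L).IsMinimal R]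
    (h1 : J.a₁ ∈ maximalIdeal R₀) (h2 : J.a₂ ∈ maximalIdeal R₀ ^ 2) {ϖ₀ γ ε : R₀}
    (hϖ : Irreducible (algebraMap R₀ R ϖ₀)) (hγ : J.a₃ = ϖ₀ ^ 2 * γ)
    (h4 : J.a₄ ∈ maximalIdeal R₀ ^ 3) (hε : J.a₆ = ϖ₀ ^ 4 * ε)
    (hdisc : residue R₀ γ ^ 2 + 4 * residue R₀ ε ≠ 0) :
    (W.baseChange L).localTamagawaNumber R = 3 ↔
      ∃ r : ResidueField R, r ^ 2 + residue R (algebraMap R₀ R γ) * r -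
        residue R (algebraMap R₀ R ε) = 0 := by
  haveI : (W.baseChange L).IsElliptic := by rw [WeierstrassCurve.baseChange]; infer_instance
  obtain ⟨h1', h2', hγ', h4', hε'⟩ := normalForm_IVstar_map R J h1 h2 hγ h4 hε
  exact localTamagawaNumber_eq_three_iff_exists_root_of_normalForm_IVstar (W.baseChange L)
    (J.map (algebraMap R₀ R)) (D.map (algebraMap F L))
    (smul_baseChange_eq_map_baseChange W J D hJ) h1' h2' hϖ hγ' h4' hε'
    ((residue_disc_map_ne_zero_iff R γ ε).mpr hdisc)

/-! ### Parity of the residue degree (type `IV`; the `IV*` twins are identical in shape) -/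

omit [IsFractionRing R₀ F] in
/-- **EVEN residue degree ⇒ `c = 3` at type `IV`** (unramified extension, `R` Henselian, `k/k₀`
finite of even degree): a quadratic over `k₀` splits in `k` (n1011-p01
`splits_map_of_natDegree_eq_two_of_even_finrank`), so the Step-5 quadratic has a root upstairs —
the INERT base-change entry of (L_ℓ)@3 at a type-`IV` place (Dokchitser–Dokchitser 2010 p. 580
Case 4c: "M/K is inert and C_v(M) = 3", corroboration only).
[cite: SilvermanATAEC1994, IV.9.4 Step 5 (PDF p. 344)] [cite: SilvermanAEC2009, Prop. VII.5.4 (a)] -/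
theorem localTamagawaNumber_baseChange_eq_three_of_even_finrank_of_normalForm_IV
    [HenselianLocalRing R] [Finite (ResidueField R)]
    (W : WeierstrassCurve F) [W.IsElliptic] (J : WeierstrassCurve R₀) (D : VariableChange F)
    (hJ : D • W = J.baseChange F) [((J.map (algebraMap R₀ R)).baseChange L).IsMinimal R]
    (h1 : J.a₁ ∈ maximalIdeal R₀) (h2 : J.a₂ ∈ maximalIdeal R₀) {ϖ₀ γ ε : R₀}
    (hϖ : Irreducible (algebraMap R₀ R ϖ₀)) (hγ : J.a₃ = ϖ₀ * γ) (h4 : J.a₄ ∈ maximalIdeal R₀ ^ 2)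
    (hε : J.a₆ = ϖ₀ ^ 2 * ε) (hdisc : residue R₀ γ ^ 2 + 4 * residue R₀ ε ≠ 0)
    (heven : Even (Module.finrank (ResidueField R₀) (ResidueField R))) :
    (W.baseChange L).localTamagawaNumber R = 3 := by
  rw [localTamagawaNumber_baseChange_eq_three_iff_of_normalForm_IV W J D hJ h1 h2 hϖ hγ h4 hε hdisc]
  have hspl := splits_map_of_natDegree_eq_two_of_even_finrank (E := ResidueField R)
    (natDegree_stepQuadratic (residue R₀ γ) (residue R₀ ε)) heven
  have key := (exists_root_map_iff_splits (algebraMap (ResidueField R₀) (ResidueField R))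
    (residue R₀ γ) (residue R₀ ε)).mpr hspl
  simpa only [ResidueField.algebraMap_residue] using key

/-- **ODD residue degree ⇒ `c` unchanged at type `IV`** (unramified extension, BOTH rings
Henselian, `k/k₀` finite of odd degree): a quadratic that splits in an odd-degree extension
already splits (n1011-p01 `splits_map_iff_of_natDegree_eq_two_of_odd_finrank`), so
`c((W ⊗ L)/L) = 3 ↔ c(W/F) = 3`. [cite: SilvermanATAEC1994, IV.9.4 Step 5 (PDF p. 344)] [cite: SilvermanAEC2009, Prop. VII.5.4 (a)] -/
theorem localTamagawaNumber_baseChange_eq_three_iff_of_odd_finrank_of_normalForm_IV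
    [HenselianLocalRing R₀] [HenselianLocalRing R] [Finite (ResidueField R)]
    (W : WeierstrassCurve F) [W.IsElliptic] (J : WeierstrassCurve R₀) (D : VariableChange F)
    (hJ : D • W = J.baseChange F) [(J.baseChange F).IsMinimal R₀]
    [((J.map (algebraMap R₀ R)).baseChange L).IsMinimal R]
    (h1 : J.a₁ ∈ maximalIdeal R₀) (h2 : J.a₂ ∈ maximalIdeal R₀) {ϖ₀ γ ε : R₀} (hϖ₀ : Irreducible ϖ₀)
    (hϖ : Irreducible (algebraMap R₀ R ϖ₀)) (hγ : J.a₃ = ϖ₀ * γ) (h4 : J.a₄ ∈ maximalIdeal R₀ ^ 2)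
    (hε : J.a₆ = ϖ₀ ^ 2 * ε) (hdisc : residue R₀ γ ^ 2 + 4 * residue R₀ ε ≠ 0)
    (hodd : Odd (Module.finrank (ResidueField R₀) (ResidueField R))) :
    (W.baseChange L).localTamagawaNumber R = 3 ↔ W.localTamagawaNumber R₀ = 3 := by
  rw [localTamagawaNumber_baseChange_eq_three_iff_of_normalForm_IV W J D hJ h1 h2 hϖ hγ h4 hε hdisc,
    localTamagawaNumber_eq_three_iff_exists_root_of_normalForm_IV W J D hJ h1 h2 hϖ₀ hγ h4 hε hdisc]
  have key := splits_map_iff_of_natDegree_eq_two_of_odd_finrank (E := ResidueField R)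
    (natDegree_stepQuadratic (residue R₀ γ) (residue R₀ ε)) hodd
  have up := exists_root_map_iff_splits (algebraMap (ResidueField R₀) (ResidueField R))
    (residue R₀ γ) (residue R₀ ε)
  have down := exists_root_map_iff_splits (RingHom.id (ResidueField R₀)) (residue R₀ γ)
    (residue R₀ ε)
  simp only [ResidueField.algebraMap_residue] at up
  simp only [RingHom.id_apply, Polynomial.map_id] at down
  rw [up, down, key]

end Extension

end TypeIVTwist

end Summit.BirchSwinnertonDyer.Rank1Residual.AdditivePotMult

end
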